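import Literature.AlgebraicGeometry.HodgeTheory.NoTypeIVFactorSimpleFactorsTotallyReal
import Literature.AlgebraicGeometry.Milne1999.CMTypeNonzeroHom
import HarnessLib

/-!
# «No simple factor of type IV» passes to abelian subvarieties, quotients, images and kernel
# components, and is detected by the simple abelian varieties mapping non-trivially to `X`
# (Mumford §19 Thm. 1, Cor. 1–2; Moonen–Zarhin 1999 §1)

Family `hodge`, layer `Literature/AlgebraicGeometry/HodgeTheory`; THEOREMS ONLY — no definition, no named fact, no
`sorry` (D-0026, net debt 0). Lane `lit-hodgefound` (Track 2 foundations library), prover seat `lit-hodgefound-p21`,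
generation 29, row g29-#5; sequel of g29-#2 `NoTypeIVFactorProductFactors` (`hasNoTypeIVFactor_prod_iff`,
`hasNoTypeIVFactor_iff_of_isIsogenous_prod`) and g29-#3 `NoTypeIVFactorSimpleFactorsTotallyReal`
(`hasNoTypeIVFactor_iff_forall_isTotallyReal_centerField_of_dim_pos`). The geometric inputs are the tree's Poincaré
complete reducibility (`AbelianVariety.poincare_complete_reducibility`, Mumford §19 Thm. 1), the identity component of
a kernel (`AbelianVariety.kerComponent`, `dim_eq_dim_add_dim_kerComponent`), images (`AbelianVariety.image`,
`toImage`, `imageι`, `isIsogenous_image_of_isSimple`, `surjective_of_isSimple`) and quasi-inverses of isogenies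
(`IsIsogeny.exists_nsmul_inverse_holds`); the pattern is that of the tree's `Milne1999/CMTypeSubquotients` (CM-type
along subvarieties and quotients), here for the type of the simple factors.

PUBLISHED STATEMENTS. Mumford, *Abelian Varieties*, §19: Thm. 1 (Poincaré: an abelian subvariety has a complement up
to isogeny), Cor. 1 (`X ∼ ∏ Xᵢ^{nᵢ}` with simple `Xᵢ`, unique up to isogeny), Cor. 2 (`End⁰(X) = ⊕ M_{nᵢ}(Dᵢ)`), Remark
p. 169 (quasi-inverses). Hence the simple factors of an abelian subvariety, of a quotient and of an image of `X` are
among the simple factors of `X`, and a simple `B` is a factor of `X` iff `Hom(B, X) ≠ 0`. Moonen–Zarhin 1999 §1: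
types I–III iff `Cent(End⁰)` totally real, type IV iff CM; «no factors of Type 4».

MAIN RESULTS (all proved):
* §1 (any algebraically closed field) `AbelianVariety.exists_isIsogenous_prod_of_isClosedImmersion` (`B ↪ A ⟹ A ∼ B × Z`),
  **`AbelianVariety.exists_isClosedImmersion_isIsogeny_comp_of_surjective`** (`h : A ↠ B ⟹` some abelian subvariety
  `j : Z ↪ A` has `j ≫ h : Z → B` an isogeny), `AbelianVariety.exists_isIsogenous_kerComponent_prod_of_surjective`
  (`A ∼ (Ker h)⁰ × Z` with `Z ∼ B`), `AbelianVariety.exists_hom_ne_zero_of_isIsogenous_biproduct_powers` (each factor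
  `B_q` of a decomposition `X ∼ ⨁_q ⨁ B_q` maps non-trivially to `X`).
* §2 **`HasNoTypeIVFactor.of_isClosedImmersion`**, `.kerComponent`, **`.of_surjective_hom`**, `.image_of_source`,
  `.image_of_target`, **`.of_hom_ne_zero_of_isSimple`** (`B` simple, `Hom(B, A) ∋ f ≠ 0`), `.of_hom_ne_zero_to_isSimple`
  (`B` simple, `Hom(A, B) ∋ f ≠ 0`), and contrapositives.
* §3 centre forms for simple `B` of positive dimension: `isTotallyReal_centerField_of_hom_ne_zero`,
  `not_hasNoTypeIVFactor_of_isCMField_centerField_of_hom_ne_zero`, and the characterization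
  **`hasNoTypeIVFactor_iff_forall_isSimple_hom_ne_zero`**: for `0 < dim A`, `HasNoTypeIVFactor A` iff every simple `B`
  of positive dimension with a non-zero homomorphism `B → A` has totally real centre `Z(End⁰ B)` — «no simple factor of
  `A` is of type IV», literally.

## References

* [MumfordAV1970] D. Mumford, *Abelian Varieties*, §19 Thm. 1, Cor. 1, Cor. 2 (pp. 173–174), Remark p. 169.
  [cite: MumfordAV1970, §19 Thm. 1 and Cor. 1 (pp. 173–174)]
* [MoonenZarhin1999LowDim] B. Moonen, Yu. Zarhin, Math. Ann. 315 (1999), §1. [cite: MoonenZarhin1999LowDim, §1 and Thm. (3.2)]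
* [LangeBirkenhake1992] H. Lange, Ch. Birkenhake, *Complex Abelian Varieties*, Prop. 1.1.12, Cor. 2.4.24, §5.5.
  [cite: LangeBirkenhake1992, Prop. 1.1.12 and Cor. 2.4.24]
* [Shimura1998] G. Shimura, *Abelian Varieties with Complex Multiplication and Modular Functions*, §5.1 Prop. 5 (p. 36).
  [cite: Shimura1998, §5.1 Proposition 5 (p. 36)]
-/

noncomputable section

open CategoryTheory CategoryTheory.Limits NumberField
open _root_.AlgebraicGeometry
open Literature.AlgebraicGeometry.Motives
open Literature.AlgebraicGeometry.ComplexMultiplication (CenterField)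

/-! ### §1 Geometry: complements of abelian subvarieties and of kernel components -/

namespace Literature.AlgebraicGeometry.Motives

namespace AbelianVariety

universe u

variable {K : Type u} [Field K] [IsAlgClosed K] {A B : AbelianVariety K}

/-- **An abelian subvariety is a factor up to isogeny**: for a closed immersion `ι : B ↪ A` there is an abelian
variety `Z` (a Poincaré complement) with `A ∼ B × Z`. [cite: MumfordAV1970, §19 Thm. 1 (pp. 173–174)] -/
theorem exists_isIsogenous_prod_of_isClosedImmersion (ι : B ⟶ A) [IsClosedImmersion (Hom.toSchemeHom ι)] :
    ∃ Z : AbelianVariety K, IsIsogenous A (B.prod Z) := by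
  obtain ⟨Z, j, -, hσ⟩ := poincare_complete_reducibility ι
  exact ⟨Z, (IsIsogenous.symm' ⟨biprod.desc ι j, hσ⟩).trans
    ⟨(biprodIsoProd B Z).hom, isIsogeny_hom_of_iso _⟩⟩

/-- **A quotient is isogenous to an abelian subvariety**: for a surjective homomorphism `h : A ↠ B` a Poincaré
complement `j : Z ↪ A` of the identity component `(Ker h)⁰ ↪ A` maps isogenously onto `B` (`j ≫ h` is a surjection
between abelian varieties of the same dimension, `dim A = dim B + dim (Ker h)⁰ = dim (Ker h)⁰ + dim Z`); and
`((Ker h)⁰, Z) : (Ker h)⁰ ⊞ Z → A` is an isogeny. (The argument of the tree's `IsOfCMType.of_surjective_hom`, recorded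
as a statement.) [cite: MumfordAV1970, §19 Thm. 1 and Remark p. 169] [cite: LangeBirkenhake1992, Prop. 1.1.12 and Cor. 2.4.24] -/
theorem exists_isClosedImmersion_isIsogeny_comp_of_surjective (h : A ⟶ B) [Surjective (Hom.toSchemeHom h)] :
    ∃ (Z : AbelianVariety K) (j : Z ⟶ A), IsClosedImmersion (Hom.toSchemeHom j) ∧ IsIsogeny (j ≫ h) ∧
      IsIsogeny (biprod.desc (kerComponentι h) j) := by
  obtain ⟨Z, j, hj, hσ⟩ := poincare_complete_reducibility (kerComponentι h)
  haveI := hj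
  -- `((Ker h)⁰, Z) ≫ h` factors through the second projection
  have hfac : biprod.desc (kerComponentι h) j ≫ h = biprod.snd ≫ (j ≫ h) := by
    apply biprod.hom_ext' <;>
      simp only [biprod.inl_desc_assoc, biprod.inr_desc_assoc, kerComponentι_comp,
        biprod.inl_snd_assoc, biprod.inr_snd_assoc, zero_comp]
  -- hence `j ≫ h : Z ⟶ B` is surjective
  haveI hσs : Surjective (Hom.toSchemeHom (biprod.desc (kerComponentι h) j)) := hσ.1
  haveI : Surjective (Hom.toSchemeHom (j ≫ h)) := by
    have hs : Surjective (Hom.toSchemeHom (biprod.desc (kerComponentι h) j ≫ h)) := by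
      rw [AbelianVariety.toSchemeHom_comp]
      infer_instance
    rw [hfac, AbelianVariety.toSchemeHom_comp] at hs
    exact Surjective.of_comp (Hom.toSchemeHom (biprod.snd : kerComponent h ⊞ Z ⟶ Z)) _
  -- and `dim Z = dim B`
  have hdim : Z.dim = B.dim := by
    have h1 : (kerComponent h ⊞ Z).dim = A.dim := dim_eq_of_isIsogeny hσ
    have h2 : (kerComponent h ⊞ Z).dim = ((kerComponent h).prod Z).dim :=
      dim_eq_of_isIsogeny (isIsogeny_hom_of_iso (biprodIsoProd (kerComponent h) Z))
    have h3 := dim_prod (kerComponent h) Z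
    have h4 := dim_eq_dim_add_dim_kerComponent h
    omega
  exact ⟨Z, j, hj, isIsogeny_of_surjective_of_dim_eq (j ≫ h) hdim, hσ⟩

/-- **`A ∼ (Ker h)⁰ × Z` with `Z ∼ B`** for a surjective homomorphism `h : A ↠ B`.
[cite: MumfordAV1970, §19 Thm. 1 and Remark p. 169] [cite: LangeBirkenhake1992, Prop. 1.1.12 and Cor. 2.4.24] -/
theorem exists_isIsogenous_kerComponent_prod_of_surjective (h : A ⟶ B) [Surjective (Hom.toSchemeHom h)] :
    ∃ Z : AbelianVariety K, IsIsogenous Z B ∧ IsIsogenous A ((kerComponent h).prod Z) := by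
  obtain ⟨Z, j, -, hjh, hσ⟩ := exists_isClosedImmersion_isIsogeny_comp_of_surjective h
  exact ⟨Z, ⟨j ≫ h, hjh⟩, (IsIsogenous.symm' ⟨_, hσ⟩).trans
    ⟨(biprodIsoProd (kerComponent h) Z).hom, isIsogeny_hom_of_iso _⟩⟩

omit [IsAlgClosed K] in
/-- **Each factor of a decomposition maps non-trivially to `X`**: if `u : X → ⨁_q ⨁_{Fin (m_q+1)} B_q` is an isogeny
and `0 < dim B_q`, then `B_q` has a non-zero homomorphism to `X` (the inclusion of a copy of `B_q` followed by a
quasi-inverse `τ` of `u`, `u ≫ τ = n`, `τ ≫ u = n`: if it vanished, `n ·` the inclusion would vanish).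
[cite: MumfordAV1970, §19 Cor. 1 (p. 173) and Remark p. 169] -/
theorem exists_hom_ne_zero_of_isIsogenous_biproduct_powers {X : AbelianVariety K} {Q : Type} [Fintype Q]
    [DecidableEq Q] {B : Q → AbelianVariety K} {m : Q → ℕ}
    (hX : IsIsogenous X (⨁ fun q => ⨁ fun _ : Fin (m q + 1) => B q)) (q : Q) (hq : 0 < (B q).dim) :
    ∃ f : B q ⟶ X, f ≠ 0 := by
  obtain ⟨u, hu⟩ := hX
  obtain ⟨τ, n, hn, huτ, hτu⟩ := IsIsogeny.exists_nsmul_inverse_holds hu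
  let ι : B q ⟶ ⨁ fun q => ⨁ fun _ : Fin (m q + 1) => B q :=
    biproduct.ι (fun _ : Fin (m q + 1) => B q) 0 ≫ biproduct.ι (fun q => ⨁ fun _ : Fin (m q + 1) => B q) q
  let π : (⨁ fun q => ⨁ fun _ : Fin (m q + 1) => B q) ⟶ B q :=
    biproduct.π (fun q => ⨁ fun _ : Fin (m q + 1) => B q) q ≫ biproduct.π (fun _ : Fin (m q + 1) => B q) 0
  have hιπ : ι ≫ π = 𝟙 (B q) := by
    simp only [ι, π, Category.assoc, biproduct.ι_π_self_assoc, biproduct.ι_π_self]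
  refine ⟨ι ≫ τ, fun h0 => ?_⟩
  have h1 : n • ι = 0 := by
    calc n • ι = ι ≫ (τ ≫ u) := by rw [hτu, Preadditive.comp_nsmul, Category.comp_id]
      _ = 0 := by rw [← Category.assoc, h0, zero_comp]
  have h2 : ι = 0 := hom_eq_zero_of_nsmul_eq_zero hn.ne' h1
  exact id_ne_zero_of_dim_pos hq (by rw [← hιπ, h2, zero_comp])

end AbelianVariety

end Literature.AlgebraicGeometry.Motives

/-! ### §2 `HasNoTypeIVFactor` along subvarieties, quotients, images -/

namespace Literature.AlgebraicGeometry.HodgeTheory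

variable {A B : AbelianVariety ℂ}

/-- **An abelian subvariety of a complex abelian variety without factor of type IV has no factor of type IV**
(`A ∼ B × Z`, g29-#2 `hasNoTypeIVFactor_iff_of_isIsogenous_prod`; in print: the simple factors of `B` are among
those of `A`). [cite: MumfordAV1970, §19 Thm. 1 and Cor. 1 (pp. 173–174)] [cite: MoonenZarhin1999LowDim, §1 and Thm. (3.2)] -/
theorem HasNoTypeIVFactor.of_isClosedImmersion (hA : HasNoTypeIVFactor A) (ι : B ⟶ A)
    [IsClosedImmersion (AbelianVariety.Hom.toSchemeHom ι)] : HasNoTypeIVFactor B := by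
  obtain ⟨Z, hZ⟩ := AbelianVariety.exists_isIsogenous_prod_of_isClosedImmersion ι
  exact hA.of_isIsogenous_prod_left hZ

/-- The identity component `(Ker φ)⁰_red` of a kernel inherits «no factor of type IV».
[cite: MumfordAV1970, §19 Thm. 1 (p. 173)] [cite: MoonenZarhin1999LowDim, §1 and Thm. (3.2)] -/
theorem HasNoTypeIVFactor.kerComponent (hA : HasNoTypeIVFactor A) (φ : A ⟶ B) :
    HasNoTypeIVFactor (AbelianVariety.kerComponent φ) :=
  hA.of_isClosedImmersion (AbelianVariety.kerComponentι φ)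

/-- Contrapositive: an abelian subvariety WITH a factor of type IV forces one in the ambient variety.
[cite: MumfordAV1970, §19 Thm. 1 and Cor. 1 (pp. 173–174)] -/
theorem not_hasNoTypeIVFactor_of_isClosedImmersion (hB : ¬ HasNoTypeIVFactor B) (ι : B ⟶ A)
    [IsClosedImmersion (AbelianVariety.Hom.toSchemeHom ι)] : ¬ HasNoTypeIVFactor A :=
  fun hA => hB (hA.of_isClosedImmersion ι)

/-- **A quotient of a complex abelian variety without factor of type IV has no factor of type IV**: for a surjective
homomorphism `h : A ↠ B`, `B` is isogenous to a Poincaré complement of `(Ker h)⁰` in `A`, an abelian subvariety.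
[cite: MumfordAV1970, §19 Thm. 1 and Remark p. 169] [cite: LangeBirkenhake1992, Prop. 1.1.12 and Cor. 2.4.24]
[cite: MoonenZarhin1999LowDim, §1 and Thm. (3.2)] -/
theorem HasNoTypeIVFactor.of_surjective_hom (hA : HasNoTypeIVFactor A) (h : A ⟶ B)
    [Surjective (AbelianVariety.Hom.toSchemeHom h)] : HasNoTypeIVFactor B := by
  obtain ⟨Z, j, hj, hjh, -⟩ := AbelianVariety.exists_isClosedImmersion_isIsogeny_comp_of_surjective h
  haveI := hj
  exact (hA.of_isClosedImmersion j).of_isIsogenous (AbelianVariety.IsIsogenous.symm' ⟨j ≫ h, hjh⟩)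

/-- Contrapositive for quotients. [cite: MumfordAV1970, §19 Thm. 1 and Remark p. 169] -/
theorem not_hasNoTypeIVFactor_of_surjective_hom (hB : ¬ HasNoTypeIVFactor B) (h : A ⟶ B)
    [Surjective (AbelianVariety.Hom.toSchemeHom h)] : ¬ HasNoTypeIVFactor A :=
  fun hA => hB (hA.of_surjective_hom h)

/-- The image of a homomorphism OUT OF a variety without type-IV factor has none (`A ↠ im g`).
[cite: MumfordAV1970, §19 Thm. 1 and Remark p. 169] [cite: MoonenZarhin1999LowDim, §1 and Thm. (3.2)] -/
theorem HasNoTypeIVFactor.image_of_source (hA : HasNoTypeIVFactor A) (g : A ⟶ B) :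
    HasNoTypeIVFactor (AbelianVariety.image g) :=
  hA.of_surjective_hom (AbelianVariety.toImage g)

/-- The image of a homomorphism INTO a variety without type-IV factor has none (`im g ↪ B`).
[cite: MumfordAV1970, §19 Thm. 1 and Cor. 1 (pp. 173–174)] [cite: MoonenZarhin1999LowDim, §1 and Thm. (3.2)] -/
theorem HasNoTypeIVFactor.image_of_target (hB : HasNoTypeIVFactor B) (g : A ⟶ B) :
    HasNoTypeIVFactor (AbelianVariety.image g) :=
  hB.of_isClosedImmersion (AbelianVariety.imageι g)

/-- **A simple abelian variety mapping non-trivially to `A` is a factor of `A`**: for `B` simple and `f : B → A`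
non-zero, `B ∼ im f ↪ A`, so `HasNoTypeIVFactor A → HasNoTypeIVFactor B`.
[cite: MumfordAV1970, §19 Thm. 1 and Cor. 2 (pp. 173–174)] [cite: MoonenZarhin1999LowDim, §1 and Thm. (3.2)] -/
theorem HasNoTypeIVFactor.of_hom_ne_zero_of_isSimple (hA : HasNoTypeIVFactor A) (hB : AbelianVariety.IsSimple B)
    (f : B ⟶ A) (hf : f ≠ 0) : HasNoTypeIVFactor B :=
  (hA.image_of_target f).of_isIsogenous (AbelianVariety.isIsogenous_image_of_isSimple hB f hf)

/-- **A simple abelian variety onto which `A` maps non-trivially is a factor of `A`**: for `B` simple and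
`f : A → B` non-zero, `f` is surjective (`surjective_of_isSimple`), so `HasNoTypeIVFactor A → HasNoTypeIVFactor B`.
[cite: MumfordAV1970, §19 Cor. 2 of Thm. 1 (proof)] [cite: MoonenZarhin1999LowDim, §1 and Thm. (3.2)] -/
theorem HasNoTypeIVFactor.of_hom_ne_zero_to_isSimple (hA : HasNoTypeIVFactor A) (hB : AbelianVariety.IsSimple B)
    (f : A ⟶ B) (hf : f ≠ 0) : HasNoTypeIVFactor B := by
  haveI := AbelianVariety.surjective_of_isSimple (f := f) hB hf
  exact hA.of_surjective_hom f

/-! ### §3 Simple factors read through `Hom(B, X) ≠ 0`: totally real centres -/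

/-- **A simple `B` with `Hom(B, A) ≠ 0` and `A` without type-IV factor has totally real centre `Z(End⁰ B)`.**
[cite: MoonenZarhin1999LowDim, §1 and Thm. (3.2)] [cite: Shimura1998, §5.1 Proposition 5 (p. 36)]
[cite: MumfordAV1970, §19 Thm. 1 and Cor. 2 (pp. 173–174)] -/
theorem isTotallyReal_centerField_of_hom_ne_zero (hA : HasNoTypeIVFactor A) (hB : AbelianVariety.IsSimple B)
    (hB0 : 0 < B.dim) (f : B ⟶ A) (hf : f ≠ 0) : IsTotallyReal (CenterField B hB hB0) :=
  (hasNoTypeIVFactor_iff_isTotallyReal_centerField hB hB0).1 (hA.of_hom_ne_zero_of_isSimple hB f hf)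

/-- The same for a non-zero homomorphism `A → B` onto a simple `B`. [cite: MoonenZarhin1999LowDim, §1 and Thm. (3.2)]
[cite: Shimura1998, §5.1 Proposition 5 (p. 36)] -/
theorem isTotallyReal_centerField_of_hom_ne_zero_to (hA : HasNoTypeIVFactor A) (hB : AbelianVariety.IsSimple B)
    (hB0 : 0 < B.dim) (f : A ⟶ B) (hf : f ≠ 0) : IsTotallyReal (CenterField B hB hB0) :=
  (hasNoTypeIVFactor_iff_isTotallyReal_centerField hB hB0).1 (hA.of_hom_ne_zero_to_isSimple hB f hf)

/-- **A simple abelian variety of type IV (CM centre) mapping non-trivially to `A` is a type-IV factor of `A`.**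
[cite: MoonenZarhin1999LowDim, §1 and Thm. (3.2)] [cite: Shimura1998, §5.1 Proposition 5 (p. 36)]
[cite: LangeBirkenhake1992, §5.5 (type IV: the centre is a CM field)] -/
theorem not_hasNoTypeIVFactor_of_isCMField_centerField_of_hom_ne_zero (hB : AbelianVariety.IsSimple B)
    (hB0 : 0 < B.dim) (hCM : IsCMField (CenterField B hB hB0)) (f : B ⟶ A) (hf : f ≠ 0) :
    ¬ HasNoTypeIVFactor A := fun hA =>
  (not_hasNoTypeIVFactor_iff_isCMField_centerField hB hB0).2 hCM (hA.of_hom_ne_zero_of_isSimple hB f hf)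

/-- **«NO SIMPLE FACTOR OF `A` IS OF TYPE IV», LITERALLY**: for a complex abelian variety `A` of positive dimension,
`HasNoTypeIVFactor A` iff every simple abelian variety `B` of positive dimension admitting a non-zero homomorphism
`B → A` has totally real centre `Z(End⁰ B)` (types I–III). (`→`: §3; `←`: the factors `B_q` of an isotypic
decomposition `A ∼ ⨁_q ⨁ B_q` (Mumford §19 Cor. 1, the tree's `exists_isIsogenous_biproduct_powers`) map non-trivially
to `A`, and g29-#3 reads `HasNoTypeIVFactor A` on their centres.)
[cite: MumfordAV1970, §19 Thm. 1, Cor. 1 and Cor. 2 (pp. 173–174)] [cite: MoonenZarhin1999LowDim, §1 and Thm. (3.2)]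
[cite: Shimura1998, §5.1 Proposition 5 (p. 36)] -/
theorem hasNoTypeIVFactor_iff_forall_isSimple_hom_ne_zero (hA0 : 0 < A.dim) :
    HasNoTypeIVFactor A ↔ ∀ (B : AbelianVariety ℂ) (hB : AbelianVariety.IsSimple B) (hB0 : 0 < B.dim) (f : B ⟶ A),
      f ≠ 0 → IsTotallyReal (CenterField B hB hB0) := by
  refine ⟨fun hA B hB hB0 f hf => isTotallyReal_centerField_of_hom_ne_zero hA hB hB0 f hf, fun h => ?_⟩
  obtain ⟨Q, _, _, B, m, hS, hd, -, hX⟩ := AbelianVariety.exists_isIsogenous_biproduct_powers A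
  refine (hasNoTypeIVFactor_iff_forall_isTotallyReal_centerField_of_dim_pos hS hd hA0 hX).2 fun q => ?_
  obtain ⟨f, hf⟩ := AbelianVariety.exists_hom_ne_zero_of_isIsogenous_biproduct_powers hX q (hd q)
  exact h (B q) (hS q) (hd q) f hf

/-- **`A` has a factor of type IV iff some simple `B` with CM centre maps non-trivially to `A`** (`0 < dim A`).
[cite: MumfordAV1970, §19 Thm. 1, Cor. 1 and Cor. 2 (pp. 173–174)] [cite: MoonenZarhin1999LowDim, §1 and Thm. (3.2)]
[cite: Shimura1998, §5.1 Proposition 5 (p. 36)] [cite: LangeBirkenhake1992, §5.5 (type IV: the centre is a CM field)] -/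
theorem not_hasNoTypeIVFactor_iff_exists_isSimple_isCMField_hom_ne_zero (hA0 : 0 < A.dim) :
    ¬ HasNoTypeIVFactor A ↔ ∃ (B : AbelianVariety ℂ) (hB : AbelianVariety.IsSimple B) (hB0 : 0 < B.dim) (f : B ⟶ A),
      f ≠ 0 ∧ IsCMField (CenterField B hB hB0) := by
  constructor
  · intro hA
    obtain ⟨Q, _, _, B, m, hS, hd, -, hX⟩ := AbelianVariety.exists_isIsogenous_biproduct_powers A
    haveI := AbelianVariety.nonempty_index_of_isIsogenous_biproduct hA0 hX
    obtain ⟨q, hq⟩ := (not_hasNoTypeIVFactor_iff_exists_isCMField_centerField hS hd hX).1 hA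
    obtain ⟨f, hf⟩ := AbelianVariety.exists_hom_ne_zero_of_isIsogenous_biproduct_powers hX q (hd q)
    exact ⟨B q, hS q, hd q, f, hf, hq⟩
  · rintro ⟨B, hB, hB0, f, hf, hCM⟩
    exact not_hasNoTypeIVFactor_of_isCMField_centerField_of_hom_ne_zero hB hB0 hCM f hf

end Literature.AlgebraicGeometry.HodgeTheory

end
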